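import Summits.AnomalousDissipation.AnomalousDissipation.Theorems.SawtoothPulseCascadeConstructionRegular58
import Literature.Analysis.FluidPDE.SawtoothCascadeSmooth
import Literature.Analysis.FunctionSpaces.TorusSpaceTime
import HarnessLib

/-!
# K1 `K1BoundedStrainCascade` (aside, stmt-AnomalousDissipation-20026), line `Birth` — STUB 1 `stub_fieldRegular`

Registered stub `stub_fieldRegular` of the line `Birth` (reshape r1, skeleton sha `07dcd01a`: the local
`FieldRegular (boxP γ ρN)` unfolded into tree vocabulary): at every box point `P = ⟨γ, 1/4, 2, 1, ρN⟩`,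
`γ ∈ [4, 8]`, `ρN ∈ {2, …, 7}`, the cascade field is jointly smooth on `[0,1) × 𝕋²` (tree theorem
`SawtoothCascade.cascadeFieldSmooth`, p424921) AND its space–time lift is essentially bounded on `(0,1) × 𝕋²`
— the drift hypothesis `MemLp (stLift u) ∞ …` of the tree's DEIJ criterion
`Torus.DEIJ.le_eScalarDissipation_of_balanced_growth`.

THE BOUND (`Cascade.exists_norm_field_le`, every parameter point with `δ₀ > 0`, `d > 0`, `N₀ ≥ 1`, `ρN ≥ 2`):
every `t ∈ [0,1)` lies in a phase `j` (`Cascade.exists_phase`), in whose H (resp. V) half-slot the field IS the single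
shear `(rateH j t · U j (x₂), 0)` (resp. `(0, rateV j t · U j (x₁))`) (`CascadeParams.field_eq_of_mem_H/V`);
`|rate| = |γ| bump(…)/tHalf j ≤ |γ| B π⁴ (j+1)⁴ / 45` (`B = sup bump`), `|U j| ≤ 1/(4N_j) ≤ 1/(4 ρN^j)`
(`Cascade.abs_U_le`), and `(j+1)⁴/ρN^j ≤ (j+1)⁸/ρN^j ≤ M` (`Rates.exists_pow_eight_div_pow_le`).  Measurability of the
lift on `(0,1) × ℝ²` is joint smoothness (`IsSmoothSpaceTimeOn.aestronglyMeasurable_stLift`).  No new definitions,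
no named facts.
-/

-- `Summit.<Summit>.<Problem>`: single-conjunct summit, the duplicate namespace segment is deliberate.
set_option linter.dupNamespace false

noncomputable section

open MeasureTheory Set Filter Topology
open scoped NNReal ENNReal
open Literature.Analysis Literature.Analysis.FunctionSpaces Literature.Analysis.FluidPDE
open Literature.Analysis.FluidPDE.SawtoothCascade

namespace Summit.AnomalousDissipation.AnomalousDissipation.Theorems

namespace Cascade

open CascadeParams

variable (P : CascadeParams)

/-- The unit bump is bounded: `0 ≤ bump ≤ B` (continuous on `[0,1]`, zero outside). -/
theorem exists_bump_le : ∃ B : ℝ, 0 ≤ B ∧ ∀ s, CascadeParams.bump s ≤ B := by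
  obtain ⟨C, hC⟩ := isCompact_Icc.exists_bound_of_continuousOn
    (continuous_bump.continuousOn (s := Icc (0 : ℝ) 1))
  refine ⟨max C 0, le_max_right _ _, fun s => ?_⟩
  by_cases hs : s ∈ Icc (0 : ℝ) 1
  · exact ((le_abs_self _).trans ((Real.norm_eq_abs _).symm.le.trans (hC s hs))).trans (le_max_left _ _)
  · rw [mem_Icc, not_and_or, not_le, not_le] at hs
    rcases hs with h | h
    · rw [bump_of_nonpos h.le]; exact le_max_right _ _
    · rw [bump_of_one_le h.le]; exact le_max_right _ _

/-- The Euclidean norm of a planar vector is at most the sum of the sizes of its components. -/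
theorem norm_toLp_pair_le (a b : ℝ) : ‖WithLp.toLp 2 ![a, b]‖ ≤ |a| + |b| := by
  rw [EuclideanSpace.norm_eq, Fin.sum_univ_two]
  simp only [Matrix.cons_val_zero, Matrix.cons_val_one, Real.norm_eq_abs]
  calc Real.sqrt (|a| ^ 2 + |b| ^ 2) ≤ Real.sqrt ((|a| + |b|) ^ 2) :=
        Real.sqrt_le_sqrt (by nlinarith [abs_nonneg a, abs_nonneg b])
    _ = |a| + |b| := Real.sqrt_sq (by positivity)

/-- Size of one pulse term: `|rate · U_j(y)| ≤ |γ| B / tHalf j · 1/(4 N_j)` whenever `rate = γ/tHalf j · bump(…)`. -/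
theorem abs_rate_mul_U_le {B : ℝ} (hB : ∀ s, CascadeParams.bump s ≤ B) {j : ℕ} (hδ : 0 < P.δ j)
    (hN : 0 < P.N j) (s y : ℝ) :
    |P.γ / tHalf j * CascadeParams.bump s * P.U j y| ≤ |P.γ| * B / tHalf j * (1 / (4 * P.N j)) := by
  have ht : 0 < tHalf j := tHalf_pos j
  rw [abs_mul, abs_mul, abs_div, abs_of_pos ht, abs_of_nonneg (bump_nonneg s)]
  have h1 : |P.γ| / tHalf j * CascadeParams.bump s ≤ |P.γ| * B / tHalf j := by
    calc |P.γ| / tHalf j * CascadeParams.bump s ≤ |P.γ| / tHalf j * B :=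
          mul_le_mul_of_nonneg_left (hB s) (by positivity)
      _ = |P.γ| * B / tHalf j := by ring
  exact mul_le_mul h1 (abs_U_le P hδ hN y) (abs_nonneg _) (by
    have := (bump_nonneg s).trans (hB s); positivity)

/-- The per-phase size constants are bounded in the phase index (`N₀ ≥ 1`, `ρN ≥ 2`):
`|γ| B / tHalf j · 1/(4N_j) = |γ| B π⁴ (j+1)⁴ /(180 N₀ ρN^j) ≤ |γ| B π⁴ M / 180`. -/
theorem exists_phase_size_le (hN₀ : 1 ≤ P.N₀) (hρ : 2 ≤ P.ρN) {B : ℝ} (hB0 : 0 ≤ B) :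
    ∃ A : ℝ, ∀ j : ℕ, |P.γ| * B / tHalf j * (1 / (4 * P.N j)) ≤ A := by
  have hρR : (2 : ℝ) ≤ P.ρN := by exact_mod_cast hρ
  obtain ⟨M, hM⟩ := SawtoothPulseCascade.DriftFreeClosure.Rates.exists_pow_eight_div_pow_le hρR
  refine ⟨|P.γ| * B * (Real.pi ^ 4 / 180) * M, fun j => ?_⟩
  have hρ0 : (0 : ℝ) < (P.ρN : ℝ) ^ j := by positivity
  have hN : ((P.ρN : ℝ)) ^ j ≤ (P.N j : ℝ) := by
    have : (P.N j : ℝ) = (P.N₀ : ℝ) * (P.ρN : ℝ) ^ j := by simp [CascadeParams.N]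
    rw [this]
    have h1 : (1 : ℝ) ≤ P.N₀ := by exact_mod_cast hN₀
    nlinarith
  have hj1 : (1 : ℝ) ≤ (j : ℝ) + 1 := by
    have : (0 : ℝ) ≤ j := Nat.cast_nonneg j
    linarith
  have hpow : ((j : ℝ) + 1) ^ 4 ≤ ((j : ℝ) + 1) ^ 8 := pow_le_pow_right₀ hj1 (by norm_num)
  have hratio : ((j : ℝ) + 1) ^ 4 / (P.N j : ℝ) ≤ M := by
    calc ((j : ℝ) + 1) ^ 4 / (P.N j : ℝ) ≤ ((j : ℝ) + 1) ^ 8 / (P.ρN : ℝ) ^ j := by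
          gcongr
      _ ≤ M := hM j
  have htHalf : 1 / tHalf j = Real.pi ^ 4 * ((j : ℝ) + 1) ^ 4 / 45 := by
    have hπ : Real.pi ≠ 0 := Real.pi_ne_zero
    have hj : ((j : ℝ) + 1) ≠ 0 := by positivity
    simp only [tHalf]
    field_simp
  have hNpos : (0 : ℝ) < (P.N j : ℝ) := lt_of_lt_of_le hρ0 hN
  have e : |P.γ| * B / tHalf j * (1 / (4 * P.N j)) =
      |P.γ| * B * (Real.pi ^ 4 / 180) * (((j : ℝ) + 1) ^ 4 / (P.N j : ℝ)) := by
    rw [div_eq_mul_one_div (|P.γ| * B) (tHalf j), htHalf]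
    field_simp
    ring
  rw [e]
  exact mul_le_mul_of_nonneg_left hratio (by positivity)

/-- **The cascade field is bounded on `[0,1) × 𝕋²`** (`δ₀ > 0`, `d > 0`, `N₀ ≥ 1`, `ρN ≥ 2`). -/
theorem exists_norm_field_le (hδ₀ : 0 < P.δ₀) (hd : 0 < P.d) (hN₀ : 1 ≤ P.N₀) (hρ : 2 ≤ P.ρN) :
    ∃ A : ℝ, ∀ t ∈ Ico (0 : ℝ) 1, ∀ x, ‖P.field t x‖ ≤ A := by
  obtain ⟨B, hB0, hB⟩ := exists_bump_le
  obtain ⟨A, hA⟩ := exists_phase_size_le P hN₀ hρ hB0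
  refine ⟨A, fun t ht x => ?_⟩
  obtain ⟨j, hj, hj'⟩ := exists_phase ht.1 ht.2
  have hδj : 0 < P.δ j := P.δ_pos hδ₀ hd j
  have hNj : 0 < P.N j := P.N_pos hN₀ (le_trans (by norm_num) hρ) j
  rcases le_or_gt t (tStart j + tHalf j) with hH | hV
  · have hmem : t ∈ Icc (tStart j) (tStart j + tHalf j) := ⟨hj, hH⟩
    rw [P.field_eq_of_mem_H hmem x]
    calc ‖WithLp.toLp 2 ![P.rateH j t * P.U j (Torus.repr x 1), 0]‖
        ≤ |P.rateH j t * P.U j (Torus.repr x 1)| + |(0 : ℝ)| := norm_toLp_pair_le _ _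
      _ = |P.γ / tHalf j * CascadeParams.bump ((t - tStart j) / tHalf j) * P.U j (Torus.repr x 1)| := by
          rw [abs_zero, add_zero]; rfl
      _ ≤ |P.γ| * B / tHalf j * (1 / (4 * P.N j)) := abs_rate_mul_U_le P hB hδj hNj _ _
      _ ≤ A := hA j
  · have hmem : t ∈ Icc (tStart j + tHalf j) (tStart (j + 1)) := ⟨hV.le, hj'.le⟩
    rw [P.field_eq_of_mem_V hmem x]
    calc ‖WithLp.toLp 2 ![0, P.rateV j t * P.U j (Torus.repr x 0)]‖
        ≤ |(0 : ℝ)| + |P.rateV j t * P.U j (Torus.repr x 0)| := norm_toLp_pair_le _ _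
      _ = |P.γ / tHalf j * CascadeParams.bump ((t - tStart j - tHalf j) / tHalf j) * P.U j (Torus.repr x 0)| := by
          rw [abs_zero, zero_add]; rfl
      _ ≤ |P.γ| * B / tHalf j * (1 / (4 * P.N j)) := abs_rate_mul_U_le P hB hδj hNj _ _
      _ ≤ A := hA j

/-- **Field regularity at every admissible parameter point**: joint smoothness on `[0,1) × 𝕋²`
(`cascadeFieldSmooth`) and essential boundedness of the space–time lift on `(0,1) × 𝕋²`. -/
theorem fieldRegular (hδ₀ : 0 < P.δ₀) (hd : 0 < P.d) (hN₀ : 1 ≤ P.N₀) (hρ : 2 ≤ P.ρN) :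
    CascadeFieldSmooth P ∧
      MemLp (FunctionSpaces.Torus.stLift P.field) ∞ (volume.restrict (Ioo (0 : ℝ) 1 ×ˢ univ)) := by
  have hs : CascadeFieldSmooth P := cascadeFieldSmooth P hδ₀ hd
  refine ⟨hs, ?_⟩
  obtain ⟨A, hA⟩ := exists_norm_field_le P hδ₀ hd hN₀ hρ
  have hmeas : AEStronglyMeasurable (FunctionSpaces.Torus.stLift P.field)
      (volume.restrict (Ioo (0 : ℝ) 1 ×ˢ (univ : Set (EuclideanSpace ℝ (Fin 2))))) :=
    Torus.IsSmoothSpaceTimeOn.aestronglyMeasurable_stLift hs measurableSet_Ioo Ioo_subset_Ico_self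
  refine memLp_top_of_bound hmeas A ?_
  rw [ae_restrict_iff' (measurableSet_Ioo.prod MeasurableSet.univ)]
  exact ae_of_all _ fun z hz => by
    rw [FunctionSpaces.Torus.stLift_apply]
    exact hA z.1 (Ioo_subset_Ico_self hz.1) _

end Cascade

/-- **STUB 1 `stub_fieldRegular`** of line `Birth` of the aside `K1BoundedStrainCascade` (stmt-AnomalousDissipation-20026;
reshape r1, `FieldRegular (boxP γ ρN)` unfolded): on the box `γ ∈ [4, 8]`, `ρN ∈ {2, …, 7}` (`δ₀ = ¼`, `d = 2`,
`N₀ = 1`) the cascade field is jointly smooth on `[0,1) × 𝕋²` and essentially bounded on `(0,1) × 𝕋²`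
(`Cascade.fieldRegular`; `γ` plays no role). -/
theorem SawtoothPulseCascade.K1BoundedStrainCascadeBirth.stub_fieldRegular :
    ∀ γ ∈ Icc (4 : ℝ) 8, ∀ ρN ∈ Finset.Icc 2 7,
      CascadeFieldSmooth ⟨γ, 1 / 4, 2, 1, ρN⟩ ∧
        MemLp (FunctionSpaces.Torus.stLift (CascadeParams.field ⟨γ, 1 / 4, 2, 1, ρN⟩)) ∞
          (volume.restrict (Ioo (0 : ℝ) 1 ×ˢ univ)) :=
  fun _ _ _ hρN => Cascade.fieldRegular _ (by norm_num) (by norm_num) le_rfl (Finset.mem_Icc.1 hρN).1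

end Summit.AnomalousDissipation.AnomalousDissipation.Theorems

end
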